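import Literature.Analysis.FluidPDE.PeriodicNSOrbitPersistsProofs
import HarnessLib

/-!
# The forced linear dictionary of the time-periodic Navier–Stokes lattice (Iooss 1972 §3; Henry 1981 Lemma 8.3.1):
# `linear_rolledUp_of_coeff`, `linear_classical`, `linear_core` of `TimePeriodicNSLatticeRealize` /
# `PeriodicNSOrbitPersistsProofs` with an inhomogeneity `H` on the right-hand side

Analysis/FluidPDE proof file (theorems only; no definitions, no named facts), a supplement to
`TimePeriodicNSLatticeRealize` (§D, the linear realization) and `PeriodicNSOrbitPersistsProofs`
(§E, the linearisation at the orbit).  The three entries of the linear lattice ↔ classical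
dictionary around a `τ`-periodic orbit `u` of the forced Navier–Stokes system on `T³` are
restated with an additional inhomogeneity on the right-hand side:

* `linear_core_forced`: a solution `h ∈ W` of the linearised lattice equation
  `τ⁻¹ Dₛh + L₀h + B(x₀,h) + B(h,x₀) = Y` with `Y(m) = b (2πi n) û(m) + y_H(m)`, `y_H` with all
  parabolic moments, solves the linearised projected lattice equation with that right-hand
  side and `h/Λ` has rapidly decaying extension (parabolic bootstrap);
* `linear_rolledUp_of_coeff_forced`: such a lattice solution rolls up to the linearised system
  on `T⁴`, `τ⁻¹ ∂₀W = ν ΔₓW − (U·∇ₓ)W − (W·∇ₓ)U − ∇ₓQ + b ∂₀U + H`, for a smooth complex field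
  `H` on `T⁴` with vanishing zero spatial modes entering the lattice equation through
  `Π_k Ĥ(n,k)` (pressure reconstruction);
* `linear_classical_forced`: the rolled-up identity unrolls to a smooth `τ`-periodic
  divergence-free mean-zero classical solution of `∂ₜw = L_{u(t)} w − ∇q + (bτ) ∂ₜu + H(t/τ, ·)`.

With `H = 0`, `y_H = 0` these are `linear_core`, `linear_rolledUp_of_coeff`, `linear_classical`.

## References

* G. Iooss, *Bifurcation des solutions périodiques de certains problèmes d'évolution*, /
  Arch. Rational Mech. Anal. 47 (1972) 301–329, §2–3. [Iooss1972]
* D. Henry, *Geometric Theory of Semilinear Parabolic Equations*, LNM 840 (1981), Lemma 8.3.1, Thm. 8.3.2. [Henry1981]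
* H. Kielhöfer, *Bifurcation Theory*, 2nd ed. (2012), §I.8 (PDF pp. 59–60), §I.12 (pp. 104–105). [Kielhofer2012]
-/

noncomputable section

open scoped BigOperators Topology ENNReal NNReal ComplexConjugate
open Filter Set Function MeasureTheory UnitAddTorus

namespace Literature.Analysis.FluidPDE

namespace TimePeriodicLattice

open Literature.Analysis.FunctionSpaces Literature.Analysis.FunctionSpaces.Torus
open Literature.Analysis.FunctionSpaces.EuclideanSpace
open Literature.Analysis.FluidPDE.ScalarFourier

-- BODY START
-- NOTATION START
/-- Local notation: the parabolic weight `Λ(n, k) = |n| + |k|²`. -/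
local notation:max "Λ" m:max => (|((Prod.fst m : ℤ) : ℝ)| + freqNormSq (Prod.snd m))

/-- Local notation: the convective symbol on `ℤ × ℤ³` (as in `TimePeriodicNSLattice`). -/
local notation:max "𝐍[" a ", " b "]" m:max =>
  (WithLp.toLp 2 (fun p : Fin 3 => ∑ j : Fin 3, ∑' m' : ℤ × (Fin 3 → ℤ),
    a m' j * (dsym j (Prod.snd m - Prod.snd m') * b (m - m') p)) : EuclideanSpace ℂ (Fin 3))

/-- Local notation: the lattice family `(n, k) ↦ C (Fin.cons n k)` of a family `C` on `ℤ⁴`. -/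
local notation:max "𝐋" C:max => (fun mm : ℤ × (Fin 3 → ℤ) => C (Fin.cons (Prod.fst mm) (Prod.snd mm) : Fin 4 → ℤ))

/-- Local notation: division by the weight. -/
local notation:max "𝐜" x:max => (fun mm : ℤ × (Fin 3 → ℤ) =>
  ((((|((Prod.fst mm : ℤ) : ℝ)| + freqNormSq (Prod.snd mm))⁻¹ : ℝ) : ℂ) • x mm))

/-- Local notation: multiplication by the weight. -/
local notation:max "𝐬" x:max => (fun mm : ℤ × (Fin 3 → ℤ) =>
  ((((|((Prod.fst mm : ℤ) : ℝ)| + freqNormSq (Prod.snd mm)) : ℝ) : ℂ) • x mm))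

/-- Local notation: the family of coefficients of `x ∈ W ⊂ ℓ²`. -/
local notation:max "𝐰" x:max =>
  (((x : lp (fun _ : ℤ × (Fin 3 → ℤ) => EuclideanSpace ℂ (Fin 3)) 2)) : ℤ × (Fin 3 → ℤ) → EuclideanSpace ℂ (Fin 3))

/-- Local notation: the extension `K ↦ c (K₀, tail K)` of a lattice family to `ℤ⁴`. -/
local notation:max "𝐄" c:max => (fun K : Fin 4 → ℤ => c ((K 0, Fin.tail K) : ℤ × (Fin 3 → ℤ)))

/-- Local notation: the lattice family `û(n,k) = 𝓕(complexify ∘ (U − m₀))(n,k)`. -/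
local notation:max "𝐮[" U ", " m₀ "]" => (fun mm : ℤ × (Fin 3 → ℤ) =>
  mFourierCoeff (EuclideanSpace.complexify ∘ fun y : UnitAddTorus (Fin 4) => U y - m₀)
    (Fin.cons (Prod.fst mm) (Prod.snd mm) : Fin 4 → ℤ))

/-- Local notation: the time multiplier `dₛ(n,k) = 2πi n / Λ(n,k)`. -/
local notation "dS" => (fun mm : ℤ × (Fin 3 → ℤ) =>
  (2 * Real.pi * Complex.I * ((Prod.fst mm : ℤ) : ℂ)) * ((((|((Prod.fst mm : ℤ) : ℝ)| + freqNormSq (Prod.snd mm)) : ℝ) : ℂ))⁻¹)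

/-- Local notation: the Stokes–drift multiplier `(4π²ν|k|² + 2πi m₀·k) / Λ(n,k)`. -/
local notation "dL[" ν ", " m₀ "]" => (fun mm : ℤ × (Fin 3 → ℤ) =>
  (((4 * Real.pi ^ 2 * ν * freqNormSq (Prod.snd mm) : ℝ) : ℂ) +
      2 * Real.pi * Complex.I * (∑ jj : Fin 3, ((m₀ jj : ℝ) : ℂ) * (((Prod.snd mm) jj : ℤ) : ℂ))) *
    ((((|((Prod.fst mm : ℤ) : ℝ)| + freqNormSq (Prod.snd mm)) : ℝ) : ℂ))⁻¹)

/-- Local notation: the symbol `σ_om(n,k) = 2πiomn + 4π²ν|k|² + 2πi m₀·k`. -/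
local notation "σ[" om ", " ν ", " m₀ "]" => (fun mm : ℤ × (Fin 3 → ℤ) =>
  2 * Real.pi * Complex.I * ((om : ℝ) : ℂ) * ((Prod.fst mm : ℤ) : ℂ) +
    (((4 * Real.pi ^ 2 * ν * freqNormSq (Prod.snd mm) : ℝ)) : ℂ) +
    2 * Real.pi * Complex.I * (∑ jj : Fin 3, ((m₀ jj : ℝ) : ℂ) * (((Prod.snd mm) jj : ℤ) : ℂ)))

/-- Local notation: the lattice family of the orbit `u` with period `τ`. -/
local notation:max "𝐨[" τ ", " u "]" => (fun mm : ℤ × (Fin 3 → ℤ) =>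
  mFourierCoeff (EuclideanSpace.complexify ∘ fun y : UnitAddTorus (Fin 4) => Torus.timeRoll τ u y - ∫ x, u 0 x)
    (Fin.cons (Prod.fst mm) (Prod.snd mm) : Fin 4 → ℤ))
-- NOTATION END

/-! ## §A⁸ The forced linear realization on `T⁴` -/

section Linear

variable {ν τ : ℝ} {U : UnitAddTorus (Fin 4) → EuclideanSpace ℝ (Fin 3)} {m₀ : EuclideanSpace ℝ (Fin 3)}
  {h : ℤ × (Fin 3 → ℤ) → EuclideanSpace ℂ (Fin 3)} {b : ℂ}
  {Hc : UnitAddTorus (Fin 4) → EuclideanSpace ℂ (Fin 3)}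

/-- Coefficients of a seven-term linear combination (bookkeeping). [folklore] -/
theorem mFourierCoeff_lincomb₇ {f₁ f₂ f₃ f₄ f₅ f₆ f₇ : UnitAddTorus (Fin 4) → EuclideanSpace ℂ (Fin 3)}
    (h₁ : Integrable f₁ volume) (h₂ : Integrable f₂ volume) (h₃ : Integrable f₃ volume) (h₄ : Integrable f₄ volume)
    (h₅ : Integrable f₅ volume) (h₆ : Integrable f₆ volume) (h₇ : Integrable f₇ volume) (c' : ℂ) (K : Fin 4 → ℤ) :
    mFourierCoeff (fun y => c' • f₁ y - f₂ y - f₃ y - f₄ y - f₅ y + f₆ y + f₇ y) K =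
      c' • mFourierCoeff f₁ K - mFourierCoeff f₂ K - mFourierCoeff f₃ K - mFourierCoeff f₄ K - mFourierCoeff f₅ K +
        mFourierCoeff f₆ K + mFourierCoeff f₇ K := by
  have e : (fun y => c' • f₁ y - f₂ y - f₃ y - f₄ y - f₅ y + f₆ y + f₇ y) = c' • f₁ - f₂ - f₃ - f₄ - f₅ + f₆ + f₇ := by
    funext y; simp
  rw [e, mFourierCoeff_add ((((((h₁.smul c').sub h₂).sub h₃).sub h₄).sub h₅).add h₆) h₇,
    mFourierCoeff_add (((((h₁.smul c').sub h₂).sub h₃).sub h₄).sub h₅) h₆,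
    mFourierCoeff_sub ((((h₁.smul c').sub h₂).sub h₃).sub h₄) h₅, mFourierCoeff_sub (((h₁.smul c').sub h₂).sub h₃) h₄,
    mFourierCoeff_sub ((h₁.smul c').sub h₂) h₃, mFourierCoeff_sub (h₁.smul c') h₂, mFourierCoeff_const_smul]

/-- **The rolled-up identity of a forced lattice solution** (linearised case; Iooss 1972, §3;
Henry 1981, Lemma 8.3.1, on the Fourier side): if `h` (zero spatial modes vanishing,
transversal, rapidly decaying extension) solves the linearised projected lattice equation
around the lattice data `û` of a smooth real field `U` (slice means `m₀`, divergence free),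
with right-hand side `b (2πi n) û + Π_k Ĥ`, `H` a smooth complex field on `T⁴` with vanishing
zero spatial modes, then for a smooth complex `Q`
`τ⁻¹ ∂₀W = ν ΔₓW − (U·∇ₓ)W − (W·∇ₓ)U − ∇ₓQ + b ∂₀U + H` on `T⁴`, `W = F_{𝐄 h}`. [folklore] -/
theorem linear_rolledUp_of_coeff_forced (hU : IsSmooth U)
    (hu0 : ∀ n : ℤ, 𝐮[U, m₀] ((n, 0) : ℤ × (Fin 3 → ℤ)) = 0)
    (hut : ∀ m : ℤ × (Fin 3 → ℤ), (∑ jj : Fin 3, ((m.2 jj : ℤ) : ℂ) * (𝐮[U, m₀] m) jj) = 0)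
    (hh0 : ∀ n : ℤ, h (n, 0) = 0)
    (hht : ∀ m : ℤ × (Fin 3 → ℤ), (∑ jj : Fin 3, ((m.2 jj : ℤ) : ℂ) * (h m) jj) = 0) (hhr : RapidDecay (𝐄 h))
    (hHs : IsSmooth Hc) (hH0 : ∀ n : ℤ, mFourierCoeff Hc (Fin.cons n (0 : Fin 3 → ℤ)) = 0)
    (hleq : ∀ m : ℤ × (Fin 3 → ℤ), m.2 ≠ 0 →
      (2 * Real.pi * Complex.I * ((τ⁻¹ : ℝ) : ℂ) * (m.1 : ℂ) + ((4 * Real.pi ^ 2 * ν * freqNormSq m.2 : ℝ) : ℂ) +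
          2 * Real.pi * Complex.I * (∑ jj : Fin 3, ((m₀ jj : ℝ) : ℂ) * ((m.2 jj : ℤ) : ℂ))) • h m +
        Torus.lerayCoeff m.2 (𝐍[𝐮[U, m₀], h] m + 𝐍[h, 𝐮[U, m₀]] m) =
        b • ((2 * Real.pi * Complex.I * (m.1 : ℂ)) • 𝐮[U, m₀] m) +
          Torus.lerayCoeff m.2 (mFourierCoeff Hc (Fin.cons m.1 m.2))) :
    ∃ Q : UnitAddTorus (Fin 4) → ℂ, IsSmooth Q ∧ ∀ y,
      ((τ⁻¹ : ℝ) : ℂ) • Torus.partialDeriv 0 (fourierSynth (𝐄 h)) y =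
        (ν : ℂ) • (∑ i : Fin 3, Torus.partialDeriv (Fin.succ i) (Torus.partialDeriv (Fin.succ i) (fourierSynth (𝐄 h))) y) -
          (∑ j : Fin 3, (((U y) j : ℝ) : ℂ) • Torus.partialDeriv (Fin.succ j) (fourierSynth (𝐄 h)) y) -
          (∑ j : Fin 3, ((fourierSynth (𝐄 h) y) j) • complexify (Torus.partialDeriv (Fin.succ j) U y)) -
          WithLp.toLp 2 (fun i : Fin 3 => Torus.partialDeriv (Fin.succ i) Q y) + b • complexify (Torus.partialDeriv 0 U y) +
          Hc y := by
  have hV : IsSmooth (fun y => U y - m₀) := hU.sub (isSmooth_const m₀)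
  have hVc : IsSmooth (complexify ∘ fun y => U y - m₀) := hV.comp_clm complexify.toContinuousLinearMap
  have hW : IsSmooth (fourierSynth (𝐄 h)) := hhr.isSmooth_fourierSynth
  have hWc : ∀ K, mFourierCoeff (fourierSynth (𝐄 h)) K = (𝐄 h) K := hhr.mFourierCoeff_fourierSynth
  have hLh : 𝐋 (mFourierCoeff (fourierSynth (𝐄 h))) = h := by funext m; rw [hWc]; exact ext_cons h m
  have hur : RapidDecay (𝐄 (𝐮[U, m₀])) := rapidDecay_ext_lattice hVc.rapidDecay_mFourierCoeff
  -- derivative relations for `Vc`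
  have hd1 : ∀ j z, Torus.partialDeriv j (complexify ∘ fun y => U y - m₀) z = complexify (Torus.partialDeriv j U z) := by
    intro j z
    have h1 := partialDeriv_clm_comp hV complexify.toContinuousLinearMap j z
    simp only [LinearIsometry.coe_toContinuousLinearMap] at h1
    rw [h1, partialDeriv_sub_const]
  -- the seven fields of the residual
  set Vc : UnitAddTorus (Fin 4) → EuclideanSpace ℂ (Fin 3) := complexify ∘ fun y => U y - m₀ with hVcdef
  set W : UnitAddTorus (Fin 4) → EuclideanSpace ℂ (Fin 3) := fourierSynth (𝐄 h) with hWdef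
  set L : UnitAddTorus (Fin 4) → EuclideanSpace ℂ (Fin 3) :=
    fun y => ∑ i : Fin 3, Torus.partialDeriv (Fin.succ i) (Torus.partialDeriv (Fin.succ i) W) y with hL
  set D : UnitAddTorus (Fin 4) → EuclideanSpace ℂ (Fin 3) :=
    fun y => ∑ j : Fin 3, ((m₀ j : ℝ) : ℂ) • Torus.partialDeriv (Fin.succ j) W y with hD
  set T₁ : UnitAddTorus (Fin 4) → EuclideanSpace ℂ (Fin 3) :=
    fun y => ∑ j : Fin 3, (Vc y) j • Torus.partialDeriv (Fin.succ j) W y with hT₁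
  set T₂ : UnitAddTorus (Fin 4) → EuclideanSpace ℂ (Fin 3) :=
    fun y => ∑ j : Fin 3, (W y) j • Torus.partialDeriv (Fin.succ j) Vc y with hT₂
  set E₀ : UnitAddTorus (Fin 4) → EuclideanSpace ℂ (Fin 3) := fun y => ((τ⁻¹ : ℝ) : ℂ) • Torus.partialDeriv 0 W y with hE₀
  set B : UnitAddTorus (Fin 4) → EuclideanSpace ℂ (Fin 3) := fun y => b • Torus.partialDeriv 0 Vc y with hB
  have hLs : IsSmooth L := isSmooth_fun_finsetSum _ fun i _ => (hW.partialDeriv _).partialDeriv _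
  have hDs : IsSmooth D :=
    isSmooth_fun_finsetSum _ fun j _ => isSmooth_smul_complex (isSmooth_const _) (hW.partialDeriv _)
  have hT₁s : IsSmooth T₁ := isSmooth_transport hVc hW
  have hT₂s : IsSmooth T₂ := isSmooth_transport hW hVc
  have hE₀s : IsSmooth E₀ := isSmooth_smul_complex (isSmooth_const _) (hW.partialDeriv 0)
  have hBs : IsSmooth B := isSmooth_smul_complex (isSmooth_const _) (hVc.partialDeriv 0)
  set Φ : UnitAddTorus (Fin 4) → EuclideanSpace ℂ (Fin 3) :=
    fun y => (ν : ℂ) • L y - D y - T₁ y - T₂ y - E₀ y + B y + Hc y with hΦ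
  have hΦs : IsSmooth Φ :=
    ((((((isSmooth_smul_complex (isSmooth_const _) hLs).sub hDs).sub hT₁s).sub hT₂s).sub hE₀s).add hBs).add hHs
  -- coefficients of `Φ`
  have cΦ : ∀ m : ℤ × (Fin 3 → ℤ), mFourierCoeff Φ (Fin.cons m.1 m.2) =
      (ν : ℂ) • ((((-(4 * Real.pi ^ 2 * freqNormSq m.2)) : ℝ) : ℂ) • h m) -
        (2 * Real.pi * Complex.I * (∑ jj : Fin 3, ((m₀ jj : ℝ) : ℂ) * ((m.2 jj : ℤ) : ℂ))) • h m -
        𝐍[𝐮[U, m₀], h] m - 𝐍[h, 𝐮[U, m₀]] m - ((τ⁻¹ : ℝ) : ℂ) • ((2 * Real.pi * Complex.I * (m.1 : ℂ)) • h m) +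
        b • ((2 * Real.pi * Complex.I * (m.1 : ℂ)) • 𝐮[U, m₀] m) + mFourierCoeff Hc (Fin.cons m.1 m.2) := by
    intro m
    have hv : mFourierCoeff W (Fin.cons m.1 m.2) = h m := by rw [hWc]; exact ext_cons h m
    have cL : mFourierCoeff L (Fin.cons m.1 m.2) = (((-(4 * Real.pi ^ 2 * freqNormSq m.2)) : ℝ) : ℂ) • h m := by
      rw [mFourierCoeff_laplacianX_cons hW, hv]
    have cD : mFourierCoeff D (Fin.cons m.1 m.2) =
        (2 * Real.pi * Complex.I * (∑ jj : Fin 3, ((m₀ jj : ℝ) : ℂ) * ((m.2 jj : ℤ) : ℂ))) • h m := by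
      have hint : ∀ j : Fin 3, Integrable (fun y => ((m₀ j : ℝ) : ℂ) • Torus.partialDeriv (Fin.succ j) W y) volume :=
        fun j => (((hW.partialDeriv (Fin.succ j)).continuous.const_smul ((m₀ j : ℝ) : ℂ) :)).integrable_unitAddTorus
      rw [hD, mFourierCoeff_finset_sum Finset.univ (fun j _ => hint j)]
      have : ∀ j : Fin 3, mFourierCoeff (fun y => ((m₀ j : ℝ) : ℂ) • Torus.partialDeriv (Fin.succ j) W y) (Fin.cons m.1 m.2) =
          (((m₀ j : ℝ) : ℂ) * dsym j m.2) • h m := by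
        intro j
        rw [show (fun y => ((m₀ j : ℝ) : ℂ) • Torus.partialDeriv (Fin.succ j) W y) =
            ((m₀ j : ℝ) : ℂ) • Torus.partialDeriv (Fin.succ j) W from rfl, mFourierCoeff_const_smul,
          mFourierCoeff_partialDeriv_succ_cons hW, hv, smul_smul]
      simp_rw [this, ← Finset.sum_smul]
      congr 1
      rw [Finset.mul_sum]
      refine Finset.sum_congr rfl fun j _ => ?_
      rw [dsym_apply]; ring
    have cT₁ : mFourierCoeff T₁ (Fin.cons m.1 m.2) = 𝐍[𝐮[U, m₀], h] m := by
      rw [hT₁, mFourierCoeff_transport_cons hVc hW, hLh]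
    have cT₂ : mFourierCoeff T₂ (Fin.cons m.1 m.2) = 𝐍[h, 𝐮[U, m₀]] m := by
      rw [hT₂, mFourierCoeff_transport_cons hW hVc, hLh]
    have cE : mFourierCoeff E₀ (Fin.cons m.1 m.2) = ((τ⁻¹ : ℝ) : ℂ) • ((2 * Real.pi * Complex.I * (m.1 : ℂ)) • h m) := by
      rw [show E₀ = ((τ⁻¹ : ℝ) : ℂ) • Torus.partialDeriv 0 W from rfl, mFourierCoeff_const_smul,
        mFourierCoeff_partialDeriv_zero_cons hW, hv]
    have cB : mFourierCoeff B (Fin.cons m.1 m.2) = b • ((2 * Real.pi * Complex.I * (m.1 : ℂ)) • 𝐮[U, m₀] m) := by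
      rw [show B = b • Torus.partialDeriv 0 Vc from rfl, mFourierCoeff_const_smul, mFourierCoeff_partialDeriv_zero_cons hVc]
    rw [hΦ, mFourierCoeff_lincomb₇ hLs.integrable hDs.integrable hT₁s.integrable hT₂s.integrable hE₀s.integrable
      hBs.integrable hHs.integrable, cL, cD, cT₁, cT₂, cE, cB]
  -- zero spatial modes of `Φ` vanish
  have h0' : ∀ n : ℤ, mFourierCoeff Φ (Fin.cons n 0) = 0 := by
    intro n
    have e1 := nl_cons_zero_of_rapidDecayE (a := 𝐮[U, m₀]) (b := h) hut hur hhr n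
    have e2 := nl_cons_zero_of_rapidDecayE (a := h) (b := 𝐮[U, m₀]) hht hhr hur n
    have e4 := cΦ (n, 0)
    simp only [e1, e2, hh0 n, smul_zero, sub_zero] at e4
    rw [e4, show mFourierCoeff (complexify ∘ fun y => U y - m₀) (Fin.cons n 0) = 0 from hu0 n, smul_zero, smul_zero,
      add_zero, hH0 n, add_zero]
  -- the Leray multiplier kills the coefficients of `Φ` off the zero modes
  have hP' : ∀ (n : ℤ) (k : Fin 3 → ℤ), k ≠ 0 → Torus.lerayCoeff k (mFourierCoeff Φ (Fin.cons n k)) = 0 := by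
    intro n k hk
    rw [show (Fin.cons n k : Fin 4 → ℤ) = Fin.cons ((n, k) : ℤ × (Fin 3 → ℤ)).1 ((n, k) : ℤ × (Fin 3 → ℤ)).2 from rfl, cΦ]
    have he := hleq (n, k) hk
    let P : EuclideanSpace ℂ (Fin 3) →ₗ[ℂ] EuclideanSpace ℂ (Fin 3) :=
      { toFun := Torus.lerayCoeff k, map_add' := SteadyLattice.lerayCoeff_add' k,
        map_smul' := SteadyLattice.lerayCoeff_smul' k }
    have hPw : ∀ w, P w = Torus.lerayCoeff k w := fun w => rfl
    have Ph : Torus.lerayCoeff k (h (n, k)) = h (n, k) := SteadyLattice.lerayCoeff_of_kdot_eq_zero hk (hht (n, k))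
    have Pu : Torus.lerayCoeff k (𝐮[U, m₀] (n, k)) = 𝐮[U, m₀] (n, k) :=
      SteadyLattice.lerayCoeff_of_kdot_eq_zero hk (hut (n, k))
    -- the Leray multiplier is idempotent (its image is transversal)
    have PG : Torus.lerayCoeff k (Torus.lerayCoeff k (mFourierCoeff Hc (Fin.cons n k))) =
        Torus.lerayCoeff k (mFourierCoeff Hc (Fin.cons n k)) :=
      SteadyLattice.lerayCoeff_of_kdot_eq_zero hk (SteadyLattice.kdot_lerayCoeff k _)
    set N : EuclideanSpace ℂ (Fin 3) := Torus.lerayCoeff k (𝐍[𝐮[U, m₀], h] (n, k) + 𝐍[h, 𝐮[U, m₀]] (n, k)) with hN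
    set G : EuclideanSpace ℂ (Fin 3) := Torus.lerayCoeff k (mFourierCoeff Hc (Fin.cons n k)) with hG
    set v : EuclideanSpace ℂ (Fin 3) := 𝐮[U, m₀] (n, k) with hvdef
    rw [← hPw]
    simp only [map_smul, map_sub, map_add]
    simp only [hPw, Ph, Pu]
    rw [show ∀ a c d e f g g' : EuclideanSpace ℂ (Fin 3), a - c - d - e - f + g + g' = a - c - (d + e) - f + g + g' from
      fun _ _ _ _ _ _ _ => by abel, ← SteadyLattice.lerayCoeff_add']
    change _ - _ - N - _ + _ + G = 0
    change _ + N = _ + G at he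
    ext i
    have hi := congrArg (fun w : EuclideanSpace ℂ (Fin 3) => w i) he
    simp only [PiLp.add_apply, PiLp.sub_apply, PiLp.smul_apply, smul_eq_mul, PiLp.zero_apply] at hi ⊢
    push_cast at hi ⊢
    linear_combination (-1 : ℂ) * hi
  obtain ⟨Q, hQs, hΦQ⟩ := exists_pressure hΦs h0' hP'
  refine ⟨Q, hQs, fun y => ?_⟩
  have hid := hΦQ y
  simp only [hΦ, hL, hD, hT₁, hT₂, hE₀, hB] at hid
  -- `D + T₁ = ∑ⱼ Uⱼ ∂ⱼ₊₁ W`, `T₂ = ∑ⱼ Wⱼ complexify (∂ⱼ₊₁ U)`, `∂₀ Vc = complexify ∂₀ U`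
  have hDT : (∑ j : Fin 3, ((m₀ j : ℝ) : ℂ) • Torus.partialDeriv (Fin.succ j) W y) +
      (∑ j : Fin 3, (Vc y) j • Torus.partialDeriv (Fin.succ j) W y) =
      ∑ j : Fin 3, (((U y) j : ℝ) : ℂ) • Torus.partialDeriv (Fin.succ j) W y := by
    rw [← Finset.sum_add_distrib]
    refine Finset.sum_congr rfl fun j _ => ?_
    rw [← add_smul, hVcdef, Function.comp_apply, complexify_apply, PiLp.sub_apply, Complex.ofReal_sub, add_sub_cancel]
  have hT₂' : (∑ j : Fin 3, (W y) j • Torus.partialDeriv (Fin.succ j) Vc y) =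
      ∑ j : Fin 3, (W y) j • complexify (Torus.partialDeriv (Fin.succ j) U y) :=
    Finset.sum_congr rfl fun j _ => by rw [hd1]
  rw [hd1, hT₂'] at hid
  rw [← hDT]
  -- rearrange
  have key : ∀ (a d t₁ t₂ e bb hh g : EuclideanSpace ℂ (Fin 3)), a - d - t₁ - t₂ - e + bb + hh = g →
      e = a - (d + t₁) - t₂ - g + bb + hh := by
    intro a d t₁ t₂ e bb hh g hh'; rw [← hh']; abel
  exact key _ _ _ _ _ _ _ _ hid

/-- **From the forced linear rolled-up identity to the forced linearised system around the
orbit**: with `U = timeRoll τ u`, `w(t,x) = W(t/τ, x)`, `q(t,x) = Q(t/τ, x)` one gets a smooth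
`τ`-periodic divergence-free mean-zero solution of
`∂ₜw = L_{u(t)} w − ∇q + (bτ) ∂ₜu + H(t/τ, ·)`. [folklore] -/
theorem linear_classical_forced {u : ℝ → UnitAddTorus (Fin 3) → EuclideanSpace ℝ (Fin 3)} (hτ : 0 < τ)
    (hsu : IsSmoothSpaceTimeOn univ u) (hper : Function.Periodic u τ)
    {W : UnitAddTorus (Fin 4) → EuclideanSpace ℂ (Fin 3)} (hW : IsSmooth W) {Q : UnitAddTorus (Fin 4) → ℂ} (hQ : IsSmooth Q)
    (hE : ∀ y, ((τ⁻¹ : ℝ) : ℂ) • Torus.partialDeriv 0 W y =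
        (ν : ℂ) • (∑ i : Fin 3, Torus.partialDeriv (Fin.succ i) (Torus.partialDeriv (Fin.succ i) W) y) -
          (∑ j : Fin 3, (((timeRoll τ u y) j : ℝ) : ℂ) • Torus.partialDeriv (Fin.succ j) W y) -
          (∑ j : Fin 3, ((W y) j) • complexify (Torus.partialDeriv (Fin.succ j) (timeRoll τ u) y)) -
          WithLp.toLp 2 (fun i : Fin 3 => Torus.partialDeriv (Fin.succ i) Q y) +
          b • complexify (Torus.partialDeriv 0 (timeRoll τ u) y) + Hc y)
    (hdiv : ∀ y, ∑ i : Fin 3, Torus.partialDeriv (Fin.succ i) (fun z => (W z) i) y = 0)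
    (hmean : ∀ c : UnitAddCircle, (∫ x, timeSlice W c x) = 0) :
    IsSmoothSpaceTimeOn univ (fun t : ℝ => fun x : UnitAddTorus (Fin 3) => W (Fin.cons (((τ⁻¹ * t : ℝ)) : UnitAddCircle) x)) ∧
    IsSmoothSpaceTimeOn univ (fun t : ℝ => fun x : UnitAddTorus (Fin 3) => Q (Fin.cons (((τ⁻¹ * t : ℝ)) : UnitAddCircle) x)) ∧
    (∀ t, Torus.IsDivFreeC (fun x : UnitAddTorus (Fin 3) => W (Fin.cons (((τ⁻¹ * t : ℝ)) : UnitAddCircle) x))) ∧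
    (∀ t, HasZeroMean (fun x : UnitAddTorus (Fin 3) => W (Fin.cons (((τ⁻¹ * t : ℝ)) : UnitAddCircle) x))) ∧
    Function.Periodic (fun t : ℝ => fun x : UnitAddTorus (Fin 3) => W (Fin.cons (((τ⁻¹ * t : ℝ)) : UnitAddCircle) x)) τ ∧
    ∀ t x, timeDerivWithin univ (fun t : ℝ => fun x : UnitAddTorus (Fin 3) => W (Fin.cons (((τ⁻¹ * t : ℝ)) : UnitAddCircle) x)) t x =
      Torus.linearizedNSOperator ν (u t) (fun x : UnitAddTorus (Fin 3) => W (Fin.cons (((τ⁻¹ * t : ℝ)) : UnitAddCircle) x))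
          (fun x : UnitAddTorus (Fin 3) => Q (Fin.cons (((τ⁻¹ * t : ℝ)) : UnitAddCircle) x)) x +
        (b * (τ : ℂ)) • Torus.realToComplex (timeDerivWithin univ u t x) +
        Hc (Fin.cons (((τ⁻¹ * t : ℝ)) : UnitAddCircle) x) := by
  set w : ℝ → UnitAddTorus (Fin 3) → EuclideanSpace ℂ (Fin 3) :=
    fun t x => W (Fin.cons (((τ⁻¹ * t : ℝ)) : UnitAddCircle) x) with hw
  set q : ℝ → UnitAddTorus (Fin 3) → ℂ := fun t x => Q (Fin.cons (((τ⁻¹ * t : ℝ)) : UnitAddCircle) x) with hq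
  have hτi : τ⁻¹ ≠ 0 := inv_ne_zero hτ.ne'
  have hperw : Function.Periodic w τ := by
    have := periodic_comp_cons W hτi
    rwa [inv_inv] at this
  have hrollw : timeRoll τ w = W := by
    have := timeRoll_comp_cons W hτi
    rwa [inv_inv] at this
  have hsw : IsSmoothSpaceTimeOn univ w := isSmoothSpaceTimeOn_cons hW τ⁻¹
  have hsq : IsSmoothSpaceTimeOn univ q := isSmoothSpaceTimeOn_cons hQ τ⁻¹
  refine ⟨hsw, hsq, fun t x => ?_, fun t => ?_, hperw, fun t x => ?_⟩
  · -- divergence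
    change ∑ i : Fin 3, Torus.partialDeriv i (fun x' => w t x' i) x = 0
    have : ∀ i : Fin 3, Torus.partialDeriv i (fun x' => w t x' i) x =
        Torus.partialDeriv (Fin.succ i) (fun z => (W z) i) (Fin.cons (((τ⁻¹ * t : ℝ)) : UnitAddCircle) x) := by
      intro i
      rw [partialDeriv_succ_cons]
      rfl
    simp_rw [this]
    exact hdiv _
  · -- mean
    change (∫ x, w t x) = 0
    exact hmean _
  · -- the equation at `(t, x)`, read at `y = (t/τ, x)`
    have hs : τ * (τ⁻¹ * t) = t := by field_simp
    have h0w := partialDeriv_zero_timeRoll hsw hperw (τ⁻¹ * t) x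
    rw [hrollw, hs] at h0w
    have h0u := partialDeriv_zero_timeRoll hsu hper (τ⁻¹ * t) x
    rw [hs] at h0u
    have hsl : timeSlice (timeRoll τ u) (((τ⁻¹ * t : ℝ)) : UnitAddCircle) = u t := by
      rw [timeSlice_timeRoll hper, hs]
    have hy := hE (Fin.cons (((τ⁻¹ * t : ℝ)) : UnitAddCircle) x)
    rw [h0w, h0u, ← laplacian_timeSlice hW] at hy
    -- convective term
    have hconv : (∑ j : Fin 3, (((timeRoll τ u (Fin.cons (((τ⁻¹ * t : ℝ)) : UnitAddCircle) x)) j : ℝ) : ℂ) •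
        Torus.partialDeriv (Fin.succ j) W (Fin.cons (((τ⁻¹ * t : ℝ)) : UnitAddCircle) x)) =
        Torus.convect (u t) (w t) x := by
      rw [← hsl, show w t = timeSlice W (((τ⁻¹ * t : ℝ)) : UnitAddCircle) from rfl, convect_timeSlice hW]
      exact Finset.sum_congr rfl fun j _ => Complex.coe_smul _ _
    -- stretching term
    have hstr : (∑ j : Fin 3, ((W (Fin.cons (((τ⁻¹ * t : ℝ)) : UnitAddCircle) x)) j) •
        complexify (Torus.partialDeriv (Fin.succ j) (timeRoll τ u) (Fin.cons (((τ⁻¹ * t : ℝ)) : UnitAddCircle) x))) =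
        Torus.stretch (w t) (u t) x := by
      rw [Torus.stretch]
      refine Finset.sum_congr rfl fun j _ => ?_
      rw [SteadyLattice.realToComplex_eq_complexify, ← hsl, ← partialDeriv_succ_cons]
    -- pressure term
    have hgr : (WithLp.toLp 2 (fun i : Fin 3 => Torus.partialDeriv (Fin.succ i) Q (Fin.cons (((τ⁻¹ * t : ℝ)) : UnitAddCircle) x)) :
        EuclideanSpace ℂ (Fin 3)) = Torus.gradientC (q t) x := by
      rw [Torus.gradientC]
      congr 1
      funext i
      rw [partialDeriv_succ_cons]
      rfl
    rw [hconv, hstr, hgr] at hy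
    rw [Torus.linearizedNSOperator, Torus.linConvect, SteadyLattice.realToComplex_eq_complexify]
    change timeDerivWithin univ w t x = _
    -- `hy : ↑τ⁻¹ • τ • ∂ₜw = ν • Δ(w t) x - convect - stretch - ∇q + b • complexify (τ • ∂ₜu) + H`
    have e1 : ((τ⁻¹ : ℝ) : ℂ) • (τ • timeDerivWithin univ w t x) = timeDerivWithin univ w t x := by
      rw [Complex.coe_smul, smul_smul, inv_mul_cancel₀ hτ.ne', one_smul]
    have e2 : b • complexify (τ • timeDerivWithin univ u t x) = (b * (τ : ℂ)) • complexify (timeDerivWithin univ u t x) := by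
      rw [LinearIsometry.map_smul, ← Complex.coe_smul, smul_smul]
    rw [e1, e2] at hy
    rw [hy, Complex.coe_smul]
    change ν • Torus.laplacian (w t) x - Torus.convect (u t) (w t) x - Torus.stretch (w t) (u t) x - Torus.gradientC (q t) x + _ + _ =
      ν • Torus.laplacian (w t) x - (Torus.convect (u t) (w t) x + Torus.stretch (w t) (u t) x) - Torus.gradientC (q t) x + _ + _
    abel

end Linear

/-! ## §B⁸ The forced linearised lattice equation at the orbit and its regularity -/

section Linearisation

variable {W : Submodule ℝ (lp (fun _ : ℤ × (Fin 3 → ℤ) => EuclideanSpace ℂ (Fin 3)) 2)}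

variable {ν τ : ℝ} {f : UnitAddTorus (Fin 3) → EuclideanSpace ℝ (Fin 3)}
  {u : ℝ → UnitAddTorus (Fin 3) → EuclideanSpace ℝ (Fin 3)} {p : ℝ → UnitAddTorus (Fin 3) → ℝ}

variable (hW : ∀ x : lp (fun _ : ℤ × (Fin 3 → ℤ) => EuclideanSpace ℂ (Fin 3)) 2, x ∈ W ↔
      (∀ n : ℤ, (x : ℤ × (Fin 3 → ℤ) → EuclideanSpace ℂ (Fin 3)) (n, 0) = 0) ∧
      (∀ mm : ℤ × (Fin 3 → ℤ), (∑ jj : Fin 3, ((mm.2 jj : ℤ) : ℂ) *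
        ((x : ℤ × (Fin 3 → ℤ) → EuclideanSpace ℂ (Fin 3)) mm) jj) = 0) ∧
      (∀ mm : ℤ × (Fin 3 → ℤ), (x : ℤ × (Fin 3 → ℤ) → EuclideanSpace ℂ (Fin 3)) (-mm) =
        conjVec ((x : ℤ × (Fin 3 → ℤ) → EuclideanSpace ℂ (Fin 3)) mm)))
variable {Ds L₀ : W →L[ℝ] W} (hDs : ∀ (x : W) (m : ℤ × (Fin 3 → ℤ)), (𝐰 (Ds x)) m = dS m • (𝐰 x) m)
  (hL₀ : ∀ (x : W) (m : ℤ × (Fin 3 → ℤ)), (𝐰 (L₀ x)) m = dL[ν, ∫ x, u 0 x] m • (𝐰 x) m)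
variable {B : W → W → W} (hBf : ∀ (x y : W) (m : ℤ × (Fin 3 → ℤ)), (𝐰 (B x y)) m = Torus.lerayCoeff m.2 (𝐍[𝐜 (𝐰 x), 𝐜 (𝐰 y)] m))

include hW hDs hL₀ hBf in
/-- **The forced linearised lattice equation and its regularity** (Iooss 1972, §3; Henry 1981,
Lemma 8.3.1, on the Fourier side): if `h ∈ W` solves `τ⁻¹ Dₛh + L₀h + B(x₀,h) + B(h,x₀) = Y`
at the orbit `x₀ = Λû` with `Y(m) = b (2πi n) û(m) + y_H(m)`, the family `y_H` having all
parabolic moments `∑ Λ^N ‖y_H‖² < ∞`, then `ĥ = h/Λ` solves the linearised projected lattice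
equation with right-hand side `b (2πi n) û + y_H` and has rapidly decaying extension. [folklore] -/
theorem linear_core_forced (hν : 0 < ν) (hτ : 0 < τ) (hsol : Torus.IsClassicalNSSolutionOn univ ν (fun _ => f) u p)
    (hper : Function.Periodic u τ) (hf0 : HasZeroMean f)
    (x₀ : W) (hx₀ : 𝐰 x₀ = 𝐬 (𝐨[τ, u])) (h Y : W) {b : ℂ}
    {yH : ℤ × (Fin 3 → ℤ) → EuclideanSpace ℂ (Fin 3)}
    (hyH : ∀ N : ℕ, ∑' m, ENNReal.ofReal ((|((Prod.fst m : ℤ) : ℝ)| + freqNormSq (Prod.snd m)) ^ N) * ‖yH m‖ₑ ^ 2 ≠ ⊤)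
    (hY : ∀ m, (𝐰 Y) m = b • ((2 * Real.pi * Complex.I * (m.1 : ℂ)) • 𝐨[τ, u] m) + yH m)
    (heqW : τ⁻¹ • Ds h + L₀ h + (B x₀ h + B h x₀) = Y) :
    (∀ m : ℤ × (Fin 3 → ℤ), m.2 ≠ 0 →
      (2 * Real.pi * Complex.I * ((τ⁻¹ : ℝ) : ℂ) * (m.1 : ℂ) + ((4 * Real.pi ^ 2 * ν * freqNormSq m.2 : ℝ) : ℂ) +
          2 * Real.pi * Complex.I * (∑ jj : Fin 3, ((((∫ x, u 0 x) : EuclideanSpace ℝ (Fin 3)) jj : ℝ) : ℂ) * ((m.2 jj : ℤ) : ℂ))) •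
          (𝐜 (𝐰 h)) m +
        Torus.lerayCoeff m.2 (𝐍[𝐨[τ, u], 𝐜 (𝐰 h)] m + 𝐍[𝐜 (𝐰 h), 𝐨[τ, u]] m) =
        b • ((2 * Real.pi * Complex.I * (m.1 : ℂ)) • 𝐨[τ, u] m) + yH m) ∧
    RapidDecay (𝐄 (𝐜 (𝐰 h))) := by
  have hu0 : ∀ n : ℤ, 𝐨[τ, u] ((n, 0) : ℤ × (Fin 3 → ℤ)) = 0 := orbit_zero_modes hsol hper hf0
  have hcx₀ : 𝐜 (𝐰 x₀) = 𝐨[τ, u] := by rw [hx₀]; exact cw_sw (x := 𝐨[τ, u]) hu0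
  -- the equation
  have heq : ∀ m : ℤ × (Fin 3 → ℤ), m.2 ≠ 0 →
      σ[τ⁻¹, ν, ∫ x, u 0 x] m • (𝐜 (𝐰 h)) m +
        Torus.lerayCoeff m.2 (𝐍[𝐨[τ, u], 𝐜 (𝐰 h)] m + 𝐍[𝐜 (𝐰 h), 𝐨[τ, u]] m) =
        b • ((2 * Real.pi * Complex.I * (m.1 : ℂ)) • 𝐨[τ, u] m) + yH m := by
    intro m hm
    have h1 := congrArg (fun z : W => (𝐰 z) m) heqW
    simp only at h1
    rw [coord_lin hDs hL₀ hBf h x₀ τ⁻¹ m, hcx₀, hY] at h1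
    exact h1
  refine ⟨heq, ?_⟩
  -- regularity
  obtain ⟨c, hc, hcl⟩ := exists_symbol_lower_bound (inv_pos.2 hτ) hν (∫ x, u 0 x)
  have hx0 : ∀ n : ℤ, (𝐰 h) (n, 0) = 0 := W_zero hW h
  have hx₀0 : ∀ n : ℤ, (𝐰 x₀) (n, 0) = 0 := W_zero hW x₀
  have hmomx₀ : ∀ N : ℕ, ∑' m, ENNReal.ofReal ((Λ m) ^ N) * ‖(𝐰 x₀) m‖ₑ ^ 2 ≠ ⊤ := by
    intro N; rw [hx₀]
    exact moments_of_rapidDecay (C := mFourierCoeff (complexify ∘ fun y => timeRoll τ u y - ∫ x, u 0 x))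
      (orbit_rapidDecay hsol hper) N
  -- `‖a + c‖² ≤ 2‖a‖² + 2‖c‖²`
  have hsq : ∀ a a' : EuclideanSpace ℂ (Fin 3), ‖a + a'‖ₑ ^ 2 ≤ 2 * ‖a‖ₑ ^ 2 + 2 * ‖a'‖ₑ ^ 2 := by
    intro a a'
    have h2 : ‖a + a'‖ ^ 2 ≤ 2 * ‖a‖ ^ 2 + 2 * ‖a'‖ ^ 2 := by
      have h1 : ‖a + a'‖ ^ 2 ≤ (‖a‖ + ‖a'‖) ^ 2 := pow_le_pow_left₀ (norm_nonneg _) (norm_add_le a a') 2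
      nlinarith [h1, sq_nonneg (‖a‖ - ‖a'‖)]
    calc ‖a + a'‖ₑ ^ 2 = ENNReal.ofReal (‖a + a'‖ ^ 2) := by
          rw [← ofReal_norm, ENNReal.ofReal_pow (norm_nonneg _)]
      _ ≤ ENNReal.ofReal (2 * ‖a‖ ^ 2 + 2 * ‖a'‖ ^ 2) := ENNReal.ofReal_le_ofReal h2
      _ = 2 * ‖a‖ₑ ^ 2 + 2 * ‖a'‖ₑ ^ 2 := by
          rw [ENNReal.ofReal_add (by positivity) (by positivity), ENNReal.ofReal_mul zero_le_two,
            ENNReal.ofReal_mul zero_le_two, ENNReal.ofReal_pow (norm_nonneg _),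
            ENNReal.ofReal_pow (norm_nonneg _), ofReal_norm, ofReal_norm, ENNReal.ofReal_ofNat]
  have hmomb : ∀ N : ℕ, ∑' m, ENNReal.ofReal ((Λ m) ^ N) *
      ‖(fun mm : ℤ × (Fin 3 → ℤ) => b • ((2 * Real.pi * Complex.I * (mm.1 : ℂ)) • 𝐨[τ, u] mm)) m‖ₑ ^ 2 ≠ ⊤ := by
    intro N
    have h1 : ∑' m, ENNReal.ofReal ((Λ m) ^ N) *
        ‖(fun mm : ℤ × (Fin 3 → ℤ) => b • ((2 * Real.pi * Complex.I * (mm.1 : ℂ)) • 𝐨[τ, u] mm)) m‖ₑ ^ 2 =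
        ‖b‖ₑ ^ 2 * ∑' m, ENNReal.ofReal ((Λ m) ^ N) *
          ‖(fun mm : ℤ × (Fin 3 → ℤ) => (2 * Real.pi * Complex.I * (mm.1 : ℂ)) • 𝐨[τ, u] mm) m‖ₑ ^ 2 := by
      rw [← ENNReal.tsum_mul_left]
      refine tsum_congr fun m => ?_
      simp only [enorm_smul]; ring
    rw [h1]
    refine ENNReal.mul_ne_top (ENNReal.pow_ne_top enorm_ne_top) (ne_top_of_le_ne_top ?_ (tsum_enorm_nsmul_sq_le (𝐨[τ, u]) N))
    refine ENNReal.mul_ne_top ENNReal.ofReal_ne_top (ne_top_of_le_ne_top (hmomx₀ (N + 2)) ?_)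
    rw [hx₀]
    exact ENNReal.tsum_le_tsum fun m => by gcongr; exact enorm_le_enorm_sw (x := 𝐨[τ, u]) hu0 m
  have hmomy : ∀ N : ℕ, ∑' m, ENNReal.ofReal ((Λ m) ^ N) *
      ‖(fun mm : ℤ × (Fin 3 → ℤ) => b • ((2 * Real.pi * Complex.I * (mm.1 : ℂ)) • 𝐨[τ, u] mm) + yH mm) m‖ₑ ^ 2 ≠ ⊤ := by
    intro N
    have hle : ∑' m, ENNReal.ofReal ((Λ m) ^ N) *
        ‖(fun mm : ℤ × (Fin 3 → ℤ) => b • ((2 * Real.pi * Complex.I * (mm.1 : ℂ)) • 𝐨[τ, u] mm) + yH mm) m‖ₑ ^ 2 ≤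
        2 * (∑' m, ENNReal.ofReal ((Λ m) ^ N) *
          ‖(fun mm : ℤ × (Fin 3 → ℤ) => b • ((2 * Real.pi * Complex.I * (mm.1 : ℂ)) • 𝐨[τ, u] mm)) m‖ₑ ^ 2) +
        2 * (∑' m, ENNReal.ofReal ((Λ m) ^ N) * ‖yH m‖ₑ ^ 2) := by
      rw [← ENNReal.tsum_mul_left, ← ENNReal.tsum_mul_left, ← ENNReal.tsum_add]
      refine ENNReal.tsum_le_tsum fun m => ?_
      calc ENNReal.ofReal ((Λ m) ^ N) * ‖b • ((2 * Real.pi * Complex.I * (m.1 : ℂ)) • 𝐨[τ, u] m) + yH m‖ₑ ^ 2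
          ≤ ENNReal.ofReal ((Λ m) ^ N) *
            (2 * ‖b • ((2 * Real.pi * Complex.I * (m.1 : ℂ)) • 𝐨[τ, u] m)‖ₑ ^ 2 + 2 * ‖yH m‖ₑ ^ 2) := by
            gcongr; exact hsq _ _
        _ = 2 * (ENNReal.ofReal ((Λ m) ^ N) * ‖b • ((2 * Real.pi * Complex.I * (m.1 : ℂ)) • 𝐨[τ, u] m)‖ₑ ^ 2) +
            2 * (ENNReal.ofReal ((Λ m) ^ N) * ‖yH m‖ₑ ^ 2) := by ring
    refine ne_top_of_le_ne_top ?_ hle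
    exact ENNReal.add_ne_top.2 ⟨ENNReal.mul_ne_top ENNReal.ofNat_ne_top (hmomb N),
      ENNReal.mul_ne_top ENNReal.ofNat_ne_top (hyH N)⟩
  have hineq : ∀ m : ℤ × (Fin 3 → ℤ), m.2 ≠ 0 →
      c * ‖(𝐰 h) m‖ ≤
        ‖(fun mm : ℤ × (Fin 3 → ℤ) => b • ((2 * Real.pi * Complex.I * (mm.1 : ℂ)) • 𝐨[τ, u] mm) + yH mm) m‖ +
        ‖𝐍[𝐜 (𝐰 h), 𝐜 (𝐰 h)] m‖ + ‖𝐍[𝐜 (𝐰 x₀), 𝐜 (𝐰 h)] m‖ + ‖𝐍[𝐜 (𝐰 h), 𝐜 (𝐰 x₀)] m‖ := by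
    intro m hm
    have he := heq m hm
    rw [hcx₀]
    have hL : (Λ m) ≠ 0 := ne_of_gt (lt_of_lt_of_le one_pos (one_le_wt hm))
    have hxm : ‖(𝐰 h) m‖ = Λ m * ‖(𝐜 (𝐰 h)) m‖ := by
      have e1 : ‖(𝐜 (𝐰 h)) m‖ = (Λ m)⁻¹ * ‖(𝐰 h) m‖ := by
        change ‖((((Λ m)⁻¹ : ℝ)) : ℂ) • (𝐰 h) m‖ = _
        rw [norm_smul, Complex.norm_real, Real.norm_of_nonneg (inv_nonneg.2 (wt_nonneg m))]
      rw [e1, ← mul_assoc, mul_inv_cancel₀ hL, one_mul]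
    have hσ := hcl m hm
    have h1 : ‖σ[τ⁻¹, ν, ∫ x, u 0 x] m • (𝐜 (𝐰 h)) m‖ ≤
        ‖b • ((2 * Real.pi * Complex.I * (m.1 : ℂ)) • 𝐨[τ, u] m) + yH m‖ +
          (‖𝐍[𝐨[τ, u], 𝐜 (𝐰 h)] m‖ + ‖𝐍[𝐜 (𝐰 h), 𝐨[τ, u]] m‖) := by
      rw [show σ[τ⁻¹, ν, ∫ x, u 0 x] m • (𝐜 (𝐰 h)) m =
        (b • ((2 * Real.pi * Complex.I * (m.1 : ℂ)) • 𝐨[τ, u] m) + yH m) -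
        Torus.lerayCoeff m.2 (𝐍[𝐨[τ, u], 𝐜 (𝐰 h)] m + 𝐍[𝐜 (𝐰 h), 𝐨[τ, u]] m) by rw [← he]; abel]
      refine (norm_sub_le _ _).trans (add_le_add le_rfl ?_)
      exact (SteadyLattice.norm_lerayCoeff_le _ _).trans (norm_add_le _ _)
    rw [norm_smul] at h1
    have h0 : 0 ≤ ‖𝐍[𝐜 (𝐰 h), 𝐜 (𝐰 h)] m‖ := norm_nonneg _
    calc c * ‖(𝐰 h) m‖ = (c * Λ m) * ‖(𝐜 (𝐰 h)) m‖ := by rw [hxm]; ring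
      _ ≤ ‖σ[τ⁻¹, ν, ∫ x, u 0 x] m‖ * ‖(𝐜 (𝐰 h)) m‖ := mul_le_mul_of_nonneg_right hσ (norm_nonneg _)
      _ ≤ _ := by linarith
  have hmom := moments_of_lattice_ineq hc (𝐰 h) (𝐰 x₀) _ hx0 hx₀0 (l2_tsum_enorm_sq_ne_top _) hmomx₀ hmomy hineq
  exact rapidDecay_of_moments hx0 hmom

end Linearisation

end TimePeriodicLattice

end Literature.Analysis.FluidPDE
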